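import Mathlib.FieldTheory.Galois.Infinite
import Mathlib.Algebra.GroupWithZero.Units.Fintype
import Mathlib.Algebra.Ring.GeomSum
import Literature.NumberTheory.GaloisRepresentations.LocalDualityTwoZero
import Literature.NumberTheory.GaloisRepresentations.DecompositionGroupOfCompletion
import Literature.NumberTheory.GaloisRepresentations.FrobeniusGeneration
import Literature.NumberTheory.GaloisRepresentations.EnormousSubgroup
import Literature.NumberTheory.GaloisRepresentations.ChebotarevCosetCyclotomic
import Literature.NumberTheory.Automorphic.AdicCompletionResidueCard
import HarnessLib

/-!
# `H²(F, M) = 0` for a trivial `p`-power-torsion module over a local field without `ζ_p`;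
# `H²(E_{v₀}, ad ρ̄) = 0` at a place with scalar Frobenius and `q_{v₀} ≢ 1 mod p`

Topic `Literature/NumberTheory/GaloisRepresentations`; a *proofs* file (theorems only, no
definitions, no named facts).  The step

  "By the Chebotarev density theorem, we can find a place `v₀` of `E` of degree 1 over `ℚ` such
  that `ρ̄(Frob_{v₀})` is scalar and `q_{v₀} ≢ 1 mod p` … Then
  `H²(E_{v₀}, ad ρ̄) = H⁰(E_{v₀}, ad ρ̄(1))^∨ = 0`."

of the proof of ACC+ 2023, Thm. 6.1.1 (arXiv text p. 89; it supplies hypothesis (8)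
"`H²(F_v, ad r̄_ι(π)) = 0`" of §6.5.1 for the level-raising place `v₀ ∈ S − (R ∪ S_p)`), in the
tree's vocabulary and from proved tree theorems only:

* §1 `DiscreteGaloisModule.eq_zero_of_forall_mu_apply_eq`: if `F` (characteristic `0`) has no
  `n`-th root of unity but `1`, the `Γ_F`-fixed points of `μₙ(F̄)` are trivial
  (`F̄^{Γ_F} = F`, Mathlib `InfiniteGalois.mem_range_algebraMap_iff_fixed`);
* §2 over a non-archimedean local field `F` of characteristic `0`, for a finite discrete
  `Γ_F`-module `M` killed by `p^k`: **`H²(F, M) = 0 ⟺ Hom_{Γ_F}(M, μ_{p^k}) = 0`**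
  (`subsingleton_continuousCohomology_two_iff`, the numerical local Tate duality
  `|H²(F, M)| = |Hom_{Γ_F}(M, μ_{p^k})|` of `LocalDualityTwoZero`, Serre II §5.2 Thm. 2 / Milne I
  Cor. 2.3), hence **`H²(F, M) = 0` when `Γ_F` acts trivially on `M` and `ζ_p ∉ F`**
  (`subsingleton_continuousCohomology_two_of_forall_apply_eq`: an invariant `f : M → μ_{p^k}` takes
  `Γ_F`-fixed values);
* §3 **`ζ_p ∉ F` when `p ∤ q_F (q_F − 1)`** (`forall_pow_eq_one_imp_eq_one_of_not_dvd`): a `p`-th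
  root of unity `ζ` is a unit of `𝒪_F`; its residue has order dividing `gcd(p, q_F − 1) = 1`, so
  `ζ ≡ 1 mod 𝔪`, and `0 = ζ^p − 1 = (ζ − 1)(1 + ζ + ⋯ + ζ^{p−1})` with the second factor
  `≡ p ≢ 0 mod 𝔪` a unit (no Hensel lemma is needed for this direction);
* §4 at the completion `K_v` of a number field: `v ∤ p` and `q_v ≢ 1 mod p` give
  `H²(K_v, M) = 0` for every trivial finite `p^k`-torsion module
  (`subsingleton_continuousCohomology_two_adicCompletion_of_forall_apply_eq`); if a homomorphism
  `τ` on `Γ_K` with open kernel kills every inertia group above `v` and takes a central value `c`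
  on a Frobenius above `v`, then `τ(res Γ_{K_v}) ⊆ ⟨c⟩`
  (`apply_absGaloisRestrict_adicCompletion_mem_zpowers`: `D_{𝔓₀} = res Γ_{K_v}` and
  `D_𝔓 = ⟨φ⟩ · I_𝔓 · ker τ`, tree `DecompositionGroupOfCompletion`, `FrobeniusGeneration`); scalars
  act trivially in the adjoint representation (`glAdjointRepresentation_apply_eq_self_of_…`); and
  the ASSEMBLY `subsingleton_continuousCohomology_two_adicCompletion_of_scalar_frobenius`:
  **`H²(K_v, ad τ) = 0`** for `τ : Γ_K → GL_n(k)` (`k` finite of characteristic `p`, as in ACC+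
  §6.2.1) unramified above `v` with scalar Frobenius, `v ∤ p`, `q_v ≢ 1 mod p` — the hypotheses
  being exactly the output of
  `ChebotarevCosetCyclotomic.infinite_setOf_prime_absNorm_frobenius_eq_of_not_mem_adjoinRootsOfUnity`
  (the choice of `v₀`) together with hypothesis (4) of Thm. 6.1.1 (`ρ̄(σ)` scalar);
* §5 both halves together (`infinite_setOf_scalar_frobenius_subsingleton_continuousCohomology_two`):
  for `τ : Γ_K → GL_n(k)` with open kernel and `σ ∈ Γ_K ∖ Γ_{K(ζ_p)}` with `τ(σ)` scalar there are
  infinitely many degree-one places `v ∤ p` with `q_v ≢ 1 mod p`, `τ` unramified above `v`,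
  `τ(Frob_v) = τ(σ)`, and `H²(K_v, ad τ) = 0` — the printed sentence verbatim.

Coefficients: the `H²`-statements are for FINITE discrete modules (the tree's local Tate duality),
so `k` is a finite field, as in the deformation-theoretic set-up of ACC+ §6.2.1 (`k` the residue
field of the coefficient ring `𝒪`); a residual representation valued in `GL_n(𝔽̄_p)` with finite
image is first descended to such a `k`.

## References

* [ACCGHLNSTT2023] P. B. Allen et al., *Potential automorphy over CM fields*, Ann. of Math. 197
  (2023), §6.5, proof of Thm. 6.1.1 (pp. 88–89 of the arXiv text 1812.09999, "End of the proof
  (Fontaine–Laffaille case)"), and §6.5.1 hypothesis (8).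
* [SerreGaloisCohomology1997] J.-P. Serre, *Galois Cohomology*, Springer 1997, II §5.2 Thm. 2.
* [MilneADT2006] J. S. Milne, *Arithmetic Duality Theorems*, 2nd ed. 2006, I Cor. 2.3.
* [NeukirchANT1999] J. Neukirch, *Algebraic Number Theory*, Springer 1999, I §9 Prop. (9.4)–(9.6),
  II §9 Prop. (9.6); II §5 Prop. (5.3), (5.7) (roots of unity in a `𝔭`-adic field).
* [SerreLocalFields1979] J.-P. Serre, *Local Fields*, GTM 67, Ch. I §7–§8 (decomposition group,
  Frobenius).
-/

noncomputable section

open Function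
open Field ValuativeRel

universe u

namespace Literature.NumberTheory.GaloisRepresentations

open _root_.TopRep _root_.ContRepresentation _root_.ContinuousCohomology DiscreteGaloisModule

/-! ## §1. Roots of unity and the fixed points of `Γ_F` on `μₙ` -/

section RootsOfUnity

variable {F : Type u} [Field F]

/-- If `F` has no `p`-th root of unity other than `1`, it has no `p^k`-th root of unity other
than `1`. [folklore] -/
theorem forall_pow_pow_eq_one_imp {p : ℕ} (h : ∀ ζ : F, ζ ^ p = 1 → ζ = 1) (k : ℕ) :
    ∀ ζ : F, ζ ^ p ^ k = 1 → ζ = 1 := by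
  induction k with
  | zero =>
    intro ζ hζ
    simpa using hζ
  | succ k ih =>
    intro ζ hζ
    refine ih ζ (h _ ?_)
    rw [← pow_mul, ← pow_succ]
    exact hζ

variable [CharZero F]

/-- **The `Γ_F`-fixed points of `μₙ(F̄)` come from `μₙ(F)`**: if `F` (of characteristic `0`) has
no `n`-th root of unity but `1`, then every element of the Galois module `μₙ` fixed by `Γ_F` is
trivial (`F̄^{Γ_F} = F`, Mathlib `InfiniteGalois.mem_range_algebraMap_iff_fixed`).
Ref: Serre, *Galois Cohomology*, II §1.2. [folklore] -/
theorem DiscreteGaloisModule.eq_zero_of_forall_mu_apply_eq {n : ℕ}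
    (h : ∀ ζ : F, ζ ^ n = 1 → ζ = 1) (w : MuCarrier F n)
    (hw : ∀ g : absoluteGaloisGroup F, mu F n g w = w) : w = 0 := by
  haveI : IsGalois F (AlgebraicClosure F) := {}
  set x : AlgebraicClosure F := ((muVal F n w : (AlgebraicClosure F)ˣ) : AlgebraicClosure F)
    with hx
  have hfix : ∀ g : absoluteGaloisGroup F, g • x = x := fun g => by
    have h1 := congrArg (fun y : MuCarrier F n => ((muVal F n y : (AlgebraicClosure F)ˣ) :
      AlgebraicClosure F)) (hw g)
    simpa only [muVal_apply, Units.coe_smul] using h1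
  obtain ⟨ζ, hζ⟩ := (InfiniteGalois.mem_range_algebraMap_iff_fixed x).mpr fun g => hfix g
  have hζn : ζ ^ n = 1 := by
    apply (algebraMap F (AlgebraicClosure F)).injective
    rw [map_pow, hζ, map_one, hx, ← Units.val_pow_eq_pow_val, muVal_pow_eq_one, Units.val_one]
  have hx1 : x = 1 := by rw [← hζ, h ζ hζn, map_one]
  apply muVal_injective F n
  rw [muVal_zero]
  exact Units.val_eq_one.1 hx1

end RootsOfUnity

/-! ## §2. Local Tate duality in bidegree `(2, 0)`: the vanishing criterion -/

section Local

variable (F : Type u) [Field F] [ValuativeRel F] [TopologicalSpace F] [IsNonarchimedeanLocalField F]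
  [CharZero F]
variable {M : Type u} [AddCommGroup M] [TopologicalSpace M] [DiscreteTopology M] [Finite M]

/-- **`H²(F, M) = 0 ⟺ Hom_{Γ_F}(M, μ_{p^k}) = 0`** for a finite discrete `Γ_F`-module `M` killed
by `p^k` over a non-archimedean local field `F` of characteristic `0`: immediate from the numerical
local Tate duality `|H²(F, M)| = |Hom_{Γ_F}(M, μ_{p^k})|`
(`natCard_two_eq_natCard_invariants_homRep`).
[cite: SerreGaloisCohomology1997, II §5.2 Thm. 2] [cite: MilneADT2006, I Cor. 2.3] -/
theorem subsingleton_continuousCohomology_two_iff {p k : ℕ} [Fact p.Prime]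
    (ρ : ContinuousRep (absoluteGaloisGroup F) ℤ M) (hM : ∀ m : M, p ^ k • m = 0) :
    Subsingleton (continuousCohomology 2 ρ.toTopRep) ↔
      ∀ f : HomCarrier M (MuCarrier F (p ^ k)),
        (∀ g : absoluteGaloisGroup F, ρ.homRep (mu F (p ^ k)) g f = f) → f = 0 := by
  obtain ⟨hfin, hcard⟩ := natCard_two_eq_natCard_invariants_homRep F ρ hM
  haveI := hfin
  constructor
  · intro hsub f hf
    have h1 : Nat.card (ρ.homRep (mu F (p ^ k))).toTopRep.ρ.invariants = 1 := by
      rw [← hcard]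
      exact Nat.card_of_subsingleton (0 : continuousCohomology 2 ρ.toTopRep)
    obtain ⟨hs, -⟩ := Nat.card_eq_one_iff_unique.1 h1
    have h2 := hs.elim (⟨f, hf⟩ : (ρ.homRep (mu F (p ^ k))).toTopRep.ρ.invariants) 0
    exact congrArg Subtype.val h2
  · intro h
    haveI : Subsingleton (ρ.homRep (mu F (p ^ k))).toTopRep.ρ.invariants :=
      ⟨fun a b => Subtype.ext ((h a.1 a.2).trans (h b.1 b.2).symm)⟩
    have h1 : Nat.card (continuousCohomology 2 ρ.toTopRep) = 1 := by
      rw [hcard]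
      exact Nat.card_of_subsingleton (0 : (ρ.homRep (mu F (p ^ k))).toTopRep.ρ.invariants)
    exact (Nat.card_eq_one_iff_unique.1 h1).1

/-- **`H²(F, M) = 0` for a trivial `p^k`-torsion module when `ζ_p ∉ F`.**  Let `F` be a
non-archimedean local field of characteristic `0` containing no `p`-th root of unity but `1`, and
`M` a finite discrete abelian group killed by `p^k` on which `Γ_F` acts trivially.  Then
`H²(F, M) = 0`: a `Γ_F`-invariant `f ∈ Hom(M, μ_{p^k})` is equivariant, so takes `Γ_F`-fixed
values, which are trivial (`eq_zero_of_forall_mu_apply_eq`); conclude by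
`subsingleton_continuousCohomology_two_iff`.  (Classically: `H²(F, M) ≅ H⁰(F, M^∨(1))^∨` and
`M^∨(1)^{Γ_F} = Hom(M, μ_{p^k}(F)) = 0`.)
[cite: SerreGaloisCohomology1997, II §5.2 Thm. 2] [cite: MilneADT2006, I Cor. 2.3] -/
theorem subsingleton_continuousCohomology_two_of_forall_apply_eq {p k : ℕ} [Fact p.Prime]
    (ρ : ContinuousRep (absoluteGaloisGroup F) ℤ M) (hM : ∀ m : M, p ^ k • m = 0)
    (htriv : ∀ (g : absoluteGaloisGroup F) (m : M), ρ g m = m)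
    (hμ : ∀ ζ : F, ζ ^ p = 1 → ζ = 1) :
    Subsingleton (continuousCohomology 2 ρ.toTopRep) := by
  refine (subsingleton_continuousCohomology_two_iff F ρ hM).2 fun f hf => ?_
  refine HomCarrier.ext fun m => ?_
  rw [HomCarrier.zero_apply]
  refine DiscreteGaloisModule.eq_zero_of_forall_mu_apply_eq (forall_pow_pow_eq_one_imp hμ k) (f m)
    fun g => ?_
  have h1 := (ContinuousRep.homRep_apply_eq_self_iff ρ (mu F (p ^ k)) g f).1 (hf g) m
  rwa [htriv] at h1

end Local

/-! ## §3. `ζ_p ∉ F` when `p ∤ q_F (q_F - 1)` -/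

section LocalRoots

variable (F : Type u) [Field F] [ValuativeRel F] [TopologicalSpace F] [IsNonarchimedeanLocalField F]

open IsNonarchimedeanLocalField in
/-- `p ≠ 0` in the residue field when `p ∤ q_F` (`q_F` is a power of the residue
characteristic). [folklore] -/
theorem natCast_residueField_ne_zero_of_not_dvd {p : ℕ} (hp : p.Prime)
    (hpq : ¬ p ∣ residueFieldCard F) : (p : 𝓀[F]) ≠ 0 := by
  intro h0
  obtain ⟨f, hf, hq⟩ := residueFieldCard_eq_pow_ringChar F
  have hdvd : ringChar 𝓀[F] ∣ p := (ringChar.spec 𝓀[F] p).1 h0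
  rcases hp.eq_one_or_self_of_dvd _ hdvd with h1 | h1
  · exact CharP.ringChar_ne_one h1
  · apply hpq
    rw [hq, h1]
    exact dvd_pow_self p hf.ne'

open IsNonarchimedeanLocalField in
/-- **`ζ_p ∉ F` when `p ∤ q_F (q_F − 1)`.**  Let `F` be a non-archimedean local field with
residue field of `q_F` elements and `p` a prime with `p ∤ q_F` (i.e. `p` is not the residue
characteristic) and `p ∤ q_F − 1`.  Then the only `p`-th root of unity in `F` is `1`: such a
`ζ` is a unit of `𝒪_F` (as is `ζ⁻¹`), its residue `ζ̄ ∈ 𝓀_F^×` has order dividing both `p` and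
`q_F − 1`, so `ζ̄ = 1`; then `0 = ζ^p − 1 = (1 + ζ + ⋯ + ζ^{p−1})(ζ − 1)` and the first factor
has residue `p ≠ 0`, hence is a unit, so `ζ = 1`.  (Equivalently `μ_p(F) ≠ 1 ⟺ p ∣ q_F − 1`
for `p` prime to the residue characteristic: Neukirch, *Algebraic Number Theory*, II Prop. (5.3),
`F^× = π^ℤ × μ_{q−1} × U^{(1)}` with `U^{(1)}` a `ℤ_ℓ`-module, Prop. (5.7); no Hensel lemma is
needed for the direction proved here.)
[cite: NeukirchANT1999, II §5 Prop. (5.3) and (5.7)] -/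
theorem forall_pow_eq_one_imp_eq_one_of_not_dvd {p : ℕ} [hp : Fact p.Prime]
    (hpq : ¬ p ∣ residueFieldCard F) (hq : ¬ p ∣ residueFieldCard F - 1) :
    ∀ ζ : F, ζ ^ p = 1 → ζ = 1 := by
  classical
  intro ζ hζ
  have hp' : p.Prime := hp.out
  -- `p`-th roots of unity are integral
  have hint : ∀ x : F, x ^ p = 1 → x ∈ 𝒪[F] := by
    intro x hx
    rw [Valuation.mem_integer_iff]
    by_contra hlt
    push Not at hlt
    have hinv : valuation F x⁻¹ < 1 := by
      rw [map_inv₀]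
      exact inv_lt_one_of_one_lt₀ hlt
    have h1 : valuation F (x⁻¹ ^ p) = 1 := by rw [inv_pow, hx, inv_one, map_one]
    have h2 : valuation F (x⁻¹ ^ p) < 1 := by
      rw [map_pow]
      exact pow_lt_one₀ zero_le hinv hp'.ne_zero
    exact absurd h1 h2.ne
  have hζ0 : ζ ≠ 0 := by
    rintro rfl
    rw [zero_pow hp'.ne_zero] at hζ
    exact zero_ne_one hζ
  have hζinv : ζ⁻¹ ^ p = 1 := by rw [inv_pow, hζ, inv_one]
  -- the unit `u = ζ` of `𝒪_F`
  let u : (𝒪[F])ˣ :=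
    ⟨⟨ζ, hint ζ hζ⟩, ⟨ζ⁻¹, hint _ hζinv⟩, Subtype.ext (mul_inv_cancel₀ hζ0),
      Subtype.ext (inv_mul_cancel₀ hζ0)⟩
  have hu : ((u : 𝒪[F]) : F) = ζ := rfl
  have hup : (u : 𝒪[F]) ^ p = 1 := by
    refine Subtype.ext ?_
    rw [SubmonoidClass.coe_pow, OneMemClass.coe_one]
    exact hζ
  -- its residue `ū ∈ 𝓀_F^×` is `1`
  let ub : (𝓀[F])ˣ := Units.map (IsLocalRing.residue 𝒪[F]).toMonoidHom u
  have hubp : ub ^ p = 1 := by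
    have h1 : u ^ p = 1 := Units.ext (by rw [Units.val_pow_eq_pow_val, Units.val_one]; exact hup)
    rw [← map_pow, h1, map_one]
  have hub1 : ub = 1 := by
    by_contra hne
    have hord : orderOf ub = p := orderOf_eq_prime hubp hne
    have hdvd : p ∣ Nat.card (𝓀[F])ˣ := hord ▸ orderOf_dvd_natCard ub
    rw [Nat.card_units] at hdvd
    have hq' : ¬ p ∣ Nat.card 𝓀[F] - 1 := hq
    exact hq' hdvd
  have hres1 : IsLocalRing.residue 𝒪[F] (u : 𝒪[F]) = 1 := by
    have h1 := congrArg (fun w : (𝓀[F])ˣ => (w : 𝓀[F])) hub1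
    simpa only [ub, Units.coe_map, Units.val_one, RingHom.toMonoidHom_eq_coe, MonoidHom.coe_coe] using h1
  -- the geometric sum `1 + u + ⋯ + u^{p-1}` is a unit (its residue is `p ≠ 0`)
  set S : 𝒪[F] := ∑ i ∈ Finset.range p, (u : 𝒪[F]) ^ i with hS
  have hSres : IsLocalRing.residue 𝒪[F] S = p := by
    rw [hS, map_sum]
    simp only [map_pow, hres1, one_pow, Finset.sum_const, Finset.card_range, nsmul_eq_mul, mul_one]
  have hSunit : IsUnit S := by
    by_contra hS'
    have hmem : S ∈ 𝓂[F] := (IsLocalRing.mem_maximalIdeal S).2 hS'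
    have h0 := (IsLocalRing.residue_eq_zero_iff S).2 hmem
    rw [hSres] at h0
    exact natCast_residueField_ne_zero_of_not_dvd F hp' hpq h0
  -- `0 = u^p - 1 = S (u - 1)`, so `u = 1`
  have hgeom : S * ((u : 𝒪[F]) - 1) = 0 := by rw [hS, geom_sum_mul, hup, sub_self]
  have hu1 : (u : 𝒪[F]) = 1 := sub_eq_zero.1 ((hSunit.mul_right_eq_zero).1 hgeom)
  rw [← hu, hu1, OneMemClass.coe_one]

end LocalRoots

/-! ## §4. At the completion `K_v` of a number field -/

section NumberField

open NumberField IsDedekindDomain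

variable {K : Type u} [Field K] [NumberField K] (v : HeightOneSpectrum (𝓞 K))

/-- `p ∤ q_v` when `v ∤ p` (`q_v = #(𝓞 K ⧸ v)` is a power of the residue characteristic of `v`).
[folklore] -/
theorem not_dvd_residueCard_of_natCast_not_mem {p : ℕ} (hp : p.Prime)
    (hpv : ((p : ℕ) : 𝓞 K) ∉ v.asIdeal) : ¬ p ∣ v.residueCard := by
  classical
  intro hdvd
  rw [HeightOneSpectrum.residueCard_eq_card_quotient] at hdvd
  haveI := v.isMaximal
  letI : Field (𝓞 K ⧸ v.asIdeal) := Ideal.Quotient.field v.asIdeal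
  haveI : Finite (𝓞 K ⧸ v.asIdeal) := Ideal.finiteQuotientOfFreeOfNeBot v.asIdeal v.ne_bot
  letI : Fintype (𝓞 K ⧸ v.asIdeal) := Fintype.ofFinite _
  obtain ⟨n, hprime, hcard⟩ := FiniteField.card (𝓞 K ⧸ v.asIdeal) (ringChar (𝓞 K ⧸ v.asIdeal))
  rw [Nat.card_eq_fintype_card, hcard] at hdvd
  have hpeq : p = ringChar (𝓞 K ⧸ v.asIdeal) :=
    (Nat.prime_dvd_prime_iff_eq hp hprime).1 (hp.dvd_of_dvd_pow hdvd)
  apply hpv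
  rw [← Ideal.Quotient.eq_zero_iff_mem, map_natCast, hpeq]
  exact ringChar.Nat.cast_ringChar

/-- **`ζ_p ∉ K_v` when `v ∤ p` and `q_v ≢ 1 mod p`** (`forall_pow_eq_one_imp_eq_one_of_not_dvd`
at the local field `K_v`, `residueFieldCard K_v = q_v`).
[cite: NeukirchANT1999, II §5 Prop. (5.3) and (5.7)] -/
theorem adicCompletion_pow_eq_one_imp {p : ℕ} [Fact p.Prime]
    (hpv : ((p : ℕ) : 𝓞 K) ∉ v.asIdeal) (hq : ¬ v.residueCard ≡ 1 [MOD p]) :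
    ∀ ζ : v.adicCompletion K, ζ ^ p = 1 → ζ = 1 := by
  refine forall_pow_eq_one_imp_eq_one_of_not_dvd (v.adicCompletion K) ?_ ?_
  · rw [Automorphic.residueFieldCard_adicCompletion_eq]
    exact not_dvd_residueCard_of_natCast_not_mem v Fact.out hpv
  · rw [Automorphic.residueFieldCard_adicCompletion_eq]
    intro h
    exact hq ((Nat.modEq_iff_dvd' (HeightOneSpectrum.one_lt_residueCard v).le).2 h).symm

/-- **`H²(K_v, M) = 0` for a trivial `p^k`-torsion module when `v ∤ p` and `q_v ≢ 1 mod p`.**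
Let `K` be a number field, `v` a finite place not above the prime `p` with `q_v ≢ 1 mod p`, and
`M` a finite discrete abelian group killed by `p^k` with trivial action of `Γ_{K_v}`.  Then
`H²(K_v, M) ≅ H⁰(K_v, M^∨(1))^∨ = 0` (`subsingleton_continuousCohomology_two_of_forall_apply_eq`
and `adicCompletion_pow_eq_one_imp`).  This is the computation
"`H²(E_{v₀}, ad ρ̄) = H⁰(E_{v₀}, ad ρ̄(1))^∨ = 0`" of the proof of ACC+ Thm. 6.1.1 once
`ρ̄|_{G_{E_{v₀}}}` is known to act trivially on `ad ρ̄` (below).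
[cite: ACCGHLNSTT2023, §6.5, proof of Thm. 6.1.1 (choice of v₀; p. 89 of arXiv:1812.09999)]
[cite: SerreGaloisCohomology1997, II §5.2 Thm. 2] -/
theorem subsingleton_continuousCohomology_two_adicCompletion_of_forall_apply_eq
    {p k : ℕ} [Fact p.Prime] (hpv : ((p : ℕ) : 𝓞 K) ∉ v.asIdeal) (hq : ¬ v.residueCard ≡ 1 [MOD p])
    {M : Type u} [AddCommGroup M] [TopologicalSpace M] [DiscreteTopology M] [Finite M]
    (ρ : ContinuousRep (absoluteGaloisGroup (v.adicCompletion K)) ℤ M)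
    (hM : ∀ m : M, p ^ k • m = 0)
    (htriv : ∀ (g : absoluteGaloisGroup (v.adicCompletion K)) (m : M), ρ g m = m) :
    Subsingleton (continuousCohomology 2 ρ.toTopRep) := by
  -- `K_v ⊇ K` has characteristic `0` (tree: `LocalField.charZero_adicCompletion` of
  -- `PadicAlgebraOfLocalField`, not imported here to keep the import cone small)
  haveI : CharZero (v.adicCompletion K) :=
    charZero_of_injective_algebraMap (algebraMap K (v.adicCompletion K)).injective
  exact subsingleton_continuousCohomology_two_of_forall_apply_eq (v.adicCompletion K) ρ hM htriv
    (adicCompletion_pow_eq_one_imp v hpv hq)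

/-- **`τ(res Γ_{K_v}) ⊆ ⟨c⟩` for `τ` unramified above `v` with central Frobenius value `c`.**
Let `τ : Γ_K → H` be a homomorphism with open kernel which kills the inertia group of every
prime `𝔓 ∣ v` of `\bar ℤ_K`, and suppose `τ(Φ) = c` is central for some arithmetic Frobenius
`Φ` at some `𝔓 ∣ v`.  Then `τ ∘ res` maps `Γ_{K_v}` into the cyclic group `⟨c⟩`: the image of
`res : Γ_{K_v} → Γ_K` is the decomposition group `D_{𝔓₀}` of the prime `𝔓₀ ∣ v` cut out by the
chosen embedding (`decompositionSubgroup_adicCompletionPrime_eq_range`, Neukirch II (9.6)); a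
conjugate `gΦg⁻¹` is a Frobenius at `𝔓₀` with the same value `c`; and
`D_{𝔓₀} = ⟨gΦg⁻¹⟩ · I_{𝔓₀} · ker τ` (`exists_eq_frobenius_pow_mul_of_mem_decompositionSubgroup`,
Neukirch I (9.4)).  In ACC+: "`ρ̄(Frob_{v₀})` is scalar" at a place `v₀` unramified for `ρ̄`,
so `ρ̄(G_{E_{v₀}})` consists of scalars.
[cite: NeukirchANT1999, I §9 Prop. (9.4) and II §9 Prop. (9.6)]
[cite: ACCGHLNSTT2023, §6.5, proof of Thm. 6.1.1 (choice of v₀; p. 89 of arXiv:1812.09999)] -/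
theorem apply_absGaloisRestrict_adicCompletion_mem_zpowers {H : Type*} [Group H]
    (τ : absoluteGaloisGroup K →* H) (hτ : IsOpen (τ.ker : Set (absoluteGaloisGroup K)))
    (hI : ∀ 𝔓 ∈ v.primesAbove, ∀ γ ∈ 𝔓.inertia (absoluteGaloisGroup K), τ γ = 1)
    {c : H} (hc : c ∈ Subgroup.center H)
    (hΦ : ∃ 𝔓 ∈ v.primesAbove, ∃ Φ : absoluteGaloisGroup K, IsArithFrobAt (𝓞 K) Φ 𝔓 ∧ τ Φ = c)
    (σ : absoluteGaloisGroup (v.adicCompletion K)) :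
    τ (absGaloisRestrict K (v.adicCompletion K) σ) ∈ Subgroup.zpowers c := by
  obtain ⟨𝔓, h𝔓, Φ, hΦ, hτΦ⟩ := hΦ
  have h𝔓₀ := adicCompletionPrime_mem_primesAbove K v
  obtain ⟨g, -, hΦ'⟩ :=
    HeightOneSpectrum.exists_isArithFrobAt_conj_of_mem_primesAbove_holds h𝔓 h𝔓₀ hΦ
  have hcomm : ∀ h : H, h * c = c * h := Subgroup.mem_center_iff.1 hc
  have hτΦ' : τ (g * Φ * g⁻¹) = c := by
    rw [map_mul, map_mul, hτΦ, map_inv, hcomm (τ g), mul_inv_cancel_right]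
  have hd : absGaloisRestrict K (v.adicCompletion K) σ ∈
      (adicCompletionPrime K v).decompositionSubgroup (absoluteGaloisGroup K) := by
    rw [decompositionSubgroup_adicCompletionPrime_eq_range]
    exact ⟨σ, rfl⟩
  obtain ⟨n, i, u, hi, hu, hd'⟩ :=
    exists_eq_frobenius_pow_mul_of_mem_decompositionSubgroup h𝔓₀ hΦ' hτ hd
  rw [hd', map_mul, map_mul, map_pow, hτΦ', hI _ h𝔓₀ i hi, MonoidHom.mem_ker.1 hu, mul_one,
    mul_one]
  exact Subgroup.npow_mem_zpowers c n

/-- **Scalars act trivially in the adjoint representation**: if `g ∈ GL_n(k)` is the scalar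
matrix `a · 1` then `g X g⁻¹ = X`. [folklore] -/
theorem glAdjointRepresentation_apply_eq_self_of_coe_eq_smul_one {n : Type} [Fintype n]
    [DecidableEq n] {k : Type u} [Field k] {g : GL n k} {a : k}
    (hg : ((g : GL n k) : Matrix n n k) = a • (1 : Matrix n n k)) (X : Matrix n n k) :
    glAdjointRepresentation n k g X = X := by
  rw [glAdjointRepresentation_apply]
  have hcomm : ((g : GL n k) : Matrix n n k) * X = X * ((g : GL n k) : Matrix n n k) := by
    rw [hg, smul_mul_assoc, one_mul, mul_smul_comm, mul_one]
  rw [hcomm, mul_assoc, Units.mul_inv, mul_one]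

/-- **Powers of a scalar act trivially in the adjoint representation.** [folklore] -/
theorem glAdjointRepresentation_apply_eq_self_of_mem_zpowers {n : Type} [Fintype n]
    [DecidableEq n] {k : Type u} [Field k] {c g : GL n k} {a : k}
    (hc : ((c : GL n k) : Matrix n n k) = a • (1 : Matrix n n k)) (hg : g ∈ Subgroup.zpowers c)
    (X : Matrix n n k) : glAdjointRepresentation n k g X = X := by
  have hle : Subgroup.zpowers c ≤ (glAdjointRepresentation n k).ker := by
    rw [Subgroup.zpowers_le, MonoidHom.mem_ker]
    exact LinearMap.ext fun Y => glAdjointRepresentation_apply_eq_self_of_coe_eq_smul_one hc Y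
  have h1 : glAdjointRepresentation n k g = 1 := MonoidHom.mem_ker.1 (hle hg)
  rw [h1, Module.End.one_apply]

/-- **ACC+ 2023, proof of Thm. 6.1.1: `H²(E_{v₀}, ad ρ̄) = 0` at the level-raising place.**
Let `K` be a number field, `p` a prime, `k` a finite field with `p = 0` in `k` (the residue field
of the coefficient ring, ACC+ §6.2.1), `τ : Γ_K → GL_n(k)` a homomorphism with open kernel
(e.g. the reduction `ρ̄` of a `p`-adic Galois representation), and `v` a finite place of `K` with
`v ∤ p` and `q_v ≢ 1 mod p` such that `τ` kills every inertia group above `v` and `τ(Φ)` is a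
scalar for some arithmetic Frobenius `Φ` at some prime above `v` — exactly the places produced by
`infinite_setOf_prime_absNorm_frobenius_eq_of_not_mem_adjoinRootsOfUnity`
(`ChebotarevCosetCyclotomic`) from hypothesis (4) "`ρ̄(σ)` scalar for some `σ ∈ G_F − G_{F(ζ_p)}`"
of Thm. 6.1.1.  Then for the adjoint module `ad τ|_{Γ_{K_v}}` — any continuous `ℤ`-linear action
`ρ` of `Γ_{K_v}` on `M_n(k)` given by `σ ↦ (X ↦ τ(res σ) X τ(res σ)⁻¹)` — one has
**`H²(K_v, ad τ) = 0`**: `τ(res Γ_{K_v}) ⊆ ⟨τ Φ⟩` consists of scalars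
(`apply_absGaloisRestrict_adicCompletion_mem_zpowers`), which act trivially on `M_n(k)`, and
`H²(K_v, M) = 0` for trivial `p`-torsion `M` as `ζ_p ∉ K_v`
(`subsingleton_continuousCohomology_two_adicCompletion_of_forall_apply_eq`).  This is hypothesis
(8) "`H²(F_v, ad r̄) = 0`" of ACC+ §6.5.1 for the place `v₀` ("Then
`H²(E_{v₀}, ad ρ̄) = H⁰(E_{v₀}, ad ρ̄(1))^∨ = 0`", arXiv text p. 89).
[cite: ACCGHLNSTT2023, §6.5, proof of Thm. 6.1.1 (p. 89 of arXiv:1812.09999) and §6.5.1 hyp. (8)]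
[cite: SerreGaloisCohomology1997, II §5.2 Thm. 2] -/
theorem subsingleton_continuousCohomology_two_adicCompletion_of_scalar_frobenius
    {p : ℕ} [Fact p.Prime] (hpv : ((p : ℕ) : 𝓞 K) ∉ v.asIdeal) (hq : ¬ v.residueCard ≡ 1 [MOD p])
    {n : Type} [Fintype n] [DecidableEq n] {k : Type u} [Field k] [Finite k] (hk : (p : k) = 0)
    [TopologicalSpace (Matrix n n k)] [DiscreteTopology (Matrix n n k)]
    (τ : absoluteGaloisGroup K →* GL n k) (hτ : IsOpen (τ.ker : Set (absoluteGaloisGroup K)))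
    (hI : ∀ 𝔓 ∈ v.primesAbove, ∀ γ ∈ 𝔓.inertia (absoluteGaloisGroup K), τ γ = 1)
    (hΦ : ∃ 𝔓 ∈ v.primesAbove, ∃ Φ : absoluteGaloisGroup K, IsArithFrobAt (𝓞 K) Φ 𝔓 ∧
      ∃ a : k, ((τ Φ : GL n k) : Matrix n n k) = a • (1 : Matrix n n k))
    (ρ : ContinuousRep (absoluteGaloisGroup (v.adicCompletion K)) ℤ (Matrix n n k))
    (hρ : ∀ (σ : absoluteGaloisGroup (v.adicCompletion K)) (X : Matrix n n k),
      ρ σ X = glAdjointRepresentation n k (τ (absGaloisRestrict K (v.adicCompletion K) σ)) X) :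
    Subsingleton (continuousCohomology 2 ρ.toTopRep) := by
  obtain ⟨𝔓, h𝔓, Φ, hΦ, a, ha⟩ := hΦ
  have hc : τ Φ ∈ Subgroup.center (GL n k) := by
    rw [Subgroup.mem_center_iff]
    intro g
    refine Units.ext ?_
    rw [Units.val_mul, Units.val_mul, ha, mul_smul_comm, smul_mul_assoc, mul_one, one_mul]
  have hmem := apply_absGaloisRestrict_adicCompletion_mem_zpowers v τ hτ hI hc
    ⟨𝔓, h𝔓, Φ, hΦ, rfl⟩
  have htriv : ∀ (σ : absoluteGaloisGroup (v.adicCompletion K)) (X : Matrix n n k), ρ σ X = X :=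
    fun σ X => by
      rw [hρ]
      exact glAdjointRepresentation_apply_eq_self_of_mem_zpowers ha (hmem σ) X
  have hM : ∀ X : Matrix n n k, p ^ 1 • X = 0 := fun X => by
    rw [pow_one, ← Nat.cast_smul_eq_nsmul k, hk, zero_smul]
  exact subsingleton_continuousCohomology_two_adicCompletion_of_forall_apply_eq v hpv hq ρ hM htriv

end NumberField

/-! ## §5. The level-raising place `v₀` of ACC+: Chebotarev and `H² = 0` together -/

section LevelRaisingPlace

open NumberField IsDedekindDomain

variable {K : Type} [Field K] [NumberField K]

/-- **ACC+ 2023, proof of Thm. 6.1.1 — the choice of `v₀`, with `H²(K_{v₀}, ad ρ̄) = 0`.**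
"By the Chebotarev density theorem, we can find a place `v₀` of `E` of degree 1 over `ℚ` such
that `ρ̄(Frob_{v₀})` is scalar and `q_{v₀} ≢ 1 mod p` […]. Then
`H²(E_{v₀}, ad ρ̄) = H⁰(E_{v₀}, ad ρ̄(1))^∨ = 0`."  Let `K` be a number field, `p` a prime, `k` a
finite field with `p = 0` in `k`, `τ : Γ_K → GL_n(k)` a homomorphism with open kernel, and
`σ ∈ Γ_K ∖ Γ_{K(ζ_p)}` with `τ(σ)` scalar (hypothesis (4) of Thm. 6.1.1).  Then there are
infinitely many finite places `v` of `K` of degree one (`N v` prime), not above `p`, with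
`q_v ≢ 1 mod p`, at which `τ` is unramified (it kills every inertia group above `v`) with a
Frobenius `Φ` above `v` such that `τ(Φ) = τ(σ)` — the set of
`infinite_setOf_prime_absNorm_frobenius_eq_of_not_mem_adjoinRootsOfUnity`
(`ChebotarevCosetCyclotomic`) — and at every such `v`, **`H²(K_v, ad τ) = 0`** for the adjoint
action of `Γ_{K_v}` on `M_n(k)` through `τ ∘ res`
(`subsingleton_continuousCohomology_two_adicCompletion_of_scalar_frobenius`).  (Being infinite,
the set also contains places avoiding any finite set `S` and the prime `2`, as the printed proof
requires.)
[cite: ACCGHLNSTT2023, §6.5, proof of Thm. 6.1.1 (choice of v₀; p. 89 of arXiv:1812.09999)] -/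
theorem infinite_setOf_scalar_frobenius_subsingleton_continuousCohomology_two
    {p : ℕ} [Fact p.Prime] {n : Type} [Fintype n] [DecidableEq n] {k : Type} [Field k] [Finite k]
    (hk : (p : k) = 0) [TopologicalSpace (Matrix n n k)] [DiscreteTopology (Matrix n n k)]
    (τ : absoluteGaloisGroup K →* GL n k) (hτ : IsOpen (τ.ker : Set (absoluteGaloisGroup K)))
    {σ : absoluteGaloisGroup K} (hσ : σ ∉ absGaloisGroupAdjoinRootsOfUnity K p)
    (hσa : ∃ a : k, ((τ σ : GL n k) : Matrix n n k) = a • (1 : Matrix n n k)) :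
    {v : HeightOneSpectrum (𝓞 K) | (Ideal.absNorm v.asIdeal).Prime ∧
      ((p : ℕ) : 𝓞 K) ∉ v.asIdeal ∧ ¬ v.residueCard ≡ 1 [MOD p] ∧
      (∀ 𝔓 ∈ v.primesAbove, ∀ γ ∈ 𝔓.inertia (absoluteGaloisGroup K), τ γ = 1) ∧
      (∃ 𝔓 ∈ v.primesAbove, ∃ Φ : absoluteGaloisGroup K,
        IsArithFrobAt (𝓞 K) Φ 𝔓 ∧ τ Φ = τ σ) ∧
      ∀ ρ : ContinuousRep (absoluteGaloisGroup (v.adicCompletion K)) ℤ (Matrix n n k),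
        (∀ (g : absoluteGaloisGroup (v.adicCompletion K)) (X : Matrix n n k),
          ρ g X = glAdjointRepresentation n k (τ (absGaloisRestrict K (v.adicCompletion K) g)) X) →
        Subsingleton (continuousCohomology 2 ρ.toTopRep)}.Infinite := by
  refine (infinite_setOf_prime_absNorm_frobenius_eq_of_not_mem_adjoinRootsOfUnity τ hτ hσ).mono ?_
  rintro v ⟨hprime, hpv, hq, hI, hΦ⟩
  refine ⟨hprime, hpv, hq, hI, hΦ, fun ρ hρ => ?_⟩
  obtain ⟨𝔓, h𝔓, Φ, hΦ, hτΦ⟩ := hΦ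
  obtain ⟨a, ha⟩ := hσa
  exact subsingleton_continuousCohomology_two_adicCompletion_of_scalar_frobenius v hpv hq hk τ hτ
    hI ⟨𝔓, h𝔓, Φ, hΦ, a, by rw [hτΦ]; exact ha⟩ ρ hρ

end LevelRaisingPlace

end Literature.NumberTheory.GaloisRepresentations

end
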